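import Mathlib

/-!
# Sketch (stub-ideation k4 g16) — «Is the A″ place cut mis-cut?»  Family 3 (assume the opposite) applied to the
# CUT of RSL_g's relaxed deep half `hDHrel` into the registered stubs S4₂ `stub_deepHalfAtTwoStrict` ∧ S4₀
# `stub_deepHalfAwayTwo` ∧ EH `stub_reciprocity` (`Lines/onepair.lean`, glue = tree theorem
# `Summit.BirchSwinnertonDyer.BirchSwinnertonDyer.Theorems.PlaceCutGlue.hDHrel_of_placeCut`, p-landed, k1-g9 §A / critic U37).

Mathlib-only, abstract carriers VERBATIM those of `PlaceCutGlue` (§1 `ElementGlue`): `c₂ : P₀ →ₗ[A] CharacterModule D₂`,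
`cS : PS →ₗ[A] CharacterModule DS`, `loc₂ locS : SelRel →ₗ[A] D₂ / DS`, `ld₂ ldS : H →ₗ[A] P₀ / PS`.  0 `sorry`.
Nothing here is arithmetic; BSD / RSL_g (stmt-22608) / (R≥)ᵖ (stmt-26074) are NOT proved and not claimed.

Contents.
* §0 the four registered shapes as named `Prop`s (`DeepHalfRel` = p673742's `hDHrel` with `loc' := ld₂.prod ldS`; `AtTwoStrict` = S4₂'s
  binder `h2`; `AwayTwo` = S4₀'s binder `h0`; `Recip` = EH's `hEH`) and the four "opposites" a stuck holder might be tempted by: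
  `AtTwoFree` (S4₂ minus its clause `ldS x = 0`), `AwayTwoWide` (S4₀ with SelRel-WIDE orthogonality hypothesis),
  `AtTwoMirror` / `AwayTwoMirror` (the halves of the MIRROR cut: restricted hypothesis at `2`, strictness `ld₂ x = 0` at `S₀`).
* §1 POSITIVE: `deepHalfRel_of_mirrorCut` — the mirror cut glues too (`AtTwoMirror ∧ AwayTwoMirror ∧ Recip ⟹ DeepHalfRel`), same
  `[NoZeroDivisors A]`, slack `a₁a₀`; its converse slices `awayTwoMirror_of_deepHalfRel` (free) and
  `atTwoMirror_of_deepHalfRel_of_partner` (under a partner/extension hypothesis) — so the mirror cut is lossless exactly like A″;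
  `deepHalfRelExact_of_placeCutExact` — slack bookkeeping: `a = 1` in both registered halves ⟹ `a = 1` in `hDHrel`.
* §2 NEGATIVE (separating toy data over `A := ℚ`, characters through `ℚ → ℚ/ℤ = AddCircle 1`):
  `toy₁_*` : `AtTwoFree ∧ AtTwoMirror ∧ AwayTwo ∧ AwayTwoWide ∧ Recip` hold and `DeepHalfRel` FAILS — a strictness clause on SOME
  half is necessary; in particular S4₂ without `locd_S x = 0` is NOT a fallback, and the "restricted/restricted" hybrid does not glue;
  `toy₂_*` : `AtTwoStrict ∧ AwayTwoWide ∧ AwayTwoMirror ∧ Recip` hold, `DeepHalfRel` and the registered `AwayTwo` FAIL — S4₀'s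
  Str₂-RESTRICTED hypothesis is load-bearing (the SelRel-wide weakening is useless) and the "strict/strict" hybrid does not glue;
  `toy₃_*` : `AtTwoStrict ∧ AwayTwo` hold (even slack-free), `Recip` FAILS and `DeepHalfRel` FAILS — EH is not redundant.
  Net 2×2 table: of the four cuts {A″, mirror, strict/strict, restricted/restricted} exactly the two STAGGERED ones glue.
-/

set_option autoImplicit false
set_option linter.dupNamespace false
set_option linter.unusedVariables false

noncomputable section

namespace Summit.BirchSwinnertonDyer.BirchSwinnertonDyer.Cruxes.ResidualThetaCountLowerPureAtTwo.SideaK4G16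

universe u v

/-! ## §0 The registered shapes and their "opposites" as named `Prop`s -/

section Shapes

variable {A : Type u} [CommRing A]
  {P₀ : Type v} [AddCommGroup P₀] [Module A P₀]
  {PS : Type v} [AddCommGroup PS] [Module A PS]
  {D₂ : Type v} [AddCommGroup D₂] [Module A D₂]
  {DS : Type v} [AddCommGroup DS] [Module A DS]
  {H : Type v} [AddCommGroup H] [Module A H]
  {SelRel : Type v} [AddCommGroup SelRel] [Module A SelRel]
  (c₂ : P₀ →ₗ[A] CharacterModule D₂) (cS : PS →ₗ[A] CharacterModule DS)
  (loc₂ : SelRel →ₗ[A] D₂) (locS : SelRel →ₗ[A] DS)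
  (ld₂ : H →ₗ[A] P₀) (ldS : H →ₗ[A] PS)

/-- p673742's binder `hDHrel` with `loc' := ld₂.prod ldS` (the conclusion of `PlaceCutGlue.hDHrel_of_placeCut`, VERBATIM shape). -/
def DeepHalfRel : Prop :=
  ∀ t : P₀ × PS, (∀ s : SelRel, c₂ t.1 (loc₂ s) + cS t.2 (locS s) = 0) →
    ∃ a : A, a ≠ 0 ∧ ∃ x : H, a • t = (ld₂.prod ldS) x

/-- S4₂ `stub_deepHalfAtTwoStrict` = the binder `h2` of `hDHrel_of_placeCut` (VERBATIM shape): full hypothesis, STRICT conclusion. -/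
def AtTwoStrict : Prop :=
  ∀ z : P₀, (∀ s : SelRel, c₂ z (loc₂ s) = 0) → ∃ a : A, a ≠ 0 ∧ ∃ x : H, ldS x = 0 ∧ a • z = ld₂ x

/-- S4₀ `stub_deepHalfAwayTwo` = the binder `h0` (VERBATIM shape): Str₂-RESTRICTED hypothesis, free conclusion. -/
def AwayTwo : Prop :=
  ∀ χ : PS, (∀ s : SelRel, loc₂ s = 0 → cS χ (locS s) = 0) → ∃ a : A, a ≠ 0 ∧ ∃ x : H, a • χ = ldS x

/-- EH `stub_reciprocity` = the binder `hEH` (VERBATIM shape). -/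
def Recip : Prop :=
  ∀ (x : H) (s : SelRel), c₂ (ld₂ x) (loc₂ s) + cS (ldS x) (locS s) = 0

/-- OPPOSITE 1 — S4₂ WITHOUT its clause `ldS x = 0` (the tempting fallback when `IsStrictAt` at `S₀` is the obstruction). -/
def AtTwoFree : Prop :=
  ∀ z : P₀, (∀ s : SelRel, c₂ z (loc₂ s) = 0) → ∃ a : A, a ≠ 0 ∧ ∃ x : H, a • z = ld₂ x

/-- OPPOSITE 2 — S4₀ with the SelRel-WIDE orthogonality hypothesis (a WEAKER statement than S4₀: fewer `χ` qualify). -/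
def AwayTwoWide : Prop :=
  ∀ χ : PS, (∀ s : SelRel, cS χ (locS s) = 0) → ∃ a : A, a ≠ 0 ∧ ∃ x : H, a • χ = ldS x

/-- MIRROR half at `2`: Str_S-RESTRICTED hypothesis, free conclusion (roles of `2` and `S₀` swapped w.r.t. A″). -/
def AtTwoMirror : Prop :=
  ∀ z : P₀, (∀ s : SelRel, locS s = 0 → c₂ z (loc₂ s) = 0) → ∃ a : A, a ≠ 0 ∧ ∃ x : H, a • z = ld₂ x

/-- MIRROR half away from `2`: full hypothesis, conclusion STRICT AT `2` (`ld₂ x = 0`). -/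
def AwayTwoMirror : Prop :=
  ∀ χ : PS, (∀ s : SelRel, cS χ (locS s) = 0) → ∃ a : A, a ≠ 0 ∧ ∃ x : H, ld₂ x = 0 ∧ a • χ = ldS x

/-! Trivial comparisons (which opposite is weaker than which registered shape). -/

theorem atTwoFree_of_atTwoStrict (h : AtTwoStrict c₂ loc₂ ld₂ ldS) : AtTwoFree c₂ loc₂ ld₂ (H := H) := by
  intro z hz
  obtain ⟨a, ha, x, -, hx⟩ := h z hz
  exact ⟨a, ha, x, hx⟩

theorem atTwoMirror_le_atTwoFree (h : AtTwoMirror c₂ loc₂ locS ld₂ (H := H)) : AtTwoFree c₂ loc₂ ld₂ (H := H) :=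
  fun z hz ↦ h z fun s _ ↦ hz s

theorem awayTwoWide_of_awayTwo (h : AwayTwo cS loc₂ locS ldS (H := H)) : AwayTwoWide cS locS ldS (H := H) :=
  fun χ hχ ↦ h χ fun s _ ↦ hχ s

theorem awayTwoWide_of_awayTwoMirror (h : AwayTwoMirror cS locS ld₂ ldS) : AwayTwoWide cS locS ldS (H := H) := by
  intro χ hχ
  obtain ⟨a, ha, x, -, hx⟩ := h χ hχ
  exact ⟨a, ha, x, hx⟩

end Shapes

/-! ## §1 Positive: the MIRROR cut glues, is lossless, and slack propagates multiplicatively -/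

section Mirror

variable {A : Type u} [CommRing A]
  {P₀ : Type v} [AddCommGroup P₀] [Module A P₀]
  {PS : Type v} [AddCommGroup PS] [Module A PS]
  {D₂ : Type v} [AddCommGroup D₂] [Module A D₂]
  {DS : Type v} [AddCommGroup DS] [Module A DS]
  {H : Type v} [AddCommGroup H] [Module A H]
  {SelRel : Type v} [AddCommGroup SelRel] [Module A SelRel]
  (c₂ : P₀ →ₗ[A] CharacterModule D₂) (cS : PS →ₗ[A] CharacterModule DS)
  (loc₂ : SelRel →ₗ[A] D₂) (locS : SelRel →ₗ[A] DS)
  (ld₂ : H →ₗ[A] P₀) (ldS : H →ₗ[A] PS)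

/-- **The mirror place cut glues**: `AtTwoMirror ∧ AwayTwoMirror ∧ Recip ⟹ DeepHalfRel` — the proof of
`PlaceCutGlue.hDHrel_of_placeCut` with the roles of `2` and `S₀` exchanged (first the restricted-hypothesis half at `2`,
then correct `χ` by `x₀` using reciprocity at `a₀ • s`, then the strict-at-`2` half away from `2`); slack `a₁ a₀`. -/
theorem deepHalfRel_of_mirrorCut [NoZeroDivisors A]
    (hEH : Recip c₂ cS loc₂ locS ld₂ ldS)
    (h2 : AtTwoMirror c₂ loc₂ locS ld₂ (H := H))
    (h0 : AwayTwoMirror cS locS ld₂ ldS) :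
    DeepHalfRel c₂ cS loc₂ locS ld₂ ldS := by
  rintro ⟨z, χ⟩ ht
  have hz : ∀ s : SelRel, locS s = 0 → c₂ z (loc₂ s) = 0 := by
    intro s hs
    have h := ht s
    rw [hs, map_zero, add_zero] at h
    exact h
  obtain ⟨a₀, ha₀, x₀, hx₀⟩ := h2 z hz
  have hχ' : ∀ s : SelRel, cS (a₀ • χ - ldS x₀) (locS s) = 0 := by
    intro s
    have h1 : c₂ z (loc₂ (a₀ • s)) + cS χ (locS (a₀ • s)) = 0 := ht (a₀ • s)
    rw [map_smul loc₂ a₀ s, map_smul locS a₀ s] at h1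
    have h2' : c₂ (ld₂ x₀) (loc₂ s) + cS (ldS x₀) (locS s) = 0 := hEH x₀ s
    rw [← hx₀, map_smul c₂ a₀ z, CharacterModule.smul_apply] at h2'
    have e0 : cS (a₀ • χ - ldS x₀) (locS s) = (cS χ) (a₀ • locS s) - (cS (ldS x₀)) (locS s) := by
      rw [map_sub cS, map_smul cS a₀ χ]
      rfl
    have e1 : cS χ (a₀ • locS s) = -c₂ z (a₀ • loc₂ s) := eq_neg_of_add_eq_zero_right h1
    have e2 : cS (ldS x₀) (locS s) = -c₂ z (a₀ • loc₂ s) := eq_neg_of_add_eq_zero_right h2'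
    rw [e0, e1, e2, sub_self]
  obtain ⟨a₁, ha₁, x₁, hx₁2, hx₁⟩ := h0 _ hχ'
  refine ⟨a₁ * a₀, mul_ne_zero ha₁ ha₀, a₁ • x₀ + x₁, ?_⟩
  refine Prod.ext ?_ ?_
  · show (a₁ * a₀) • z = ld₂ (a₁ • x₀ + x₁)
    rw [mul_smul, hx₀, map_add, map_smul, hx₁2, add_zero]
  · show (a₁ * a₀) • χ = ldS (a₁ • x₀ + x₁)
    rw [mul_smul, map_add, map_smul, ← hx₁, smul_sub, add_sub_cancel]

/-- Converse slice of the mirror cut away from `2` (free): `DeepHalfRel ⟹ AwayTwoMirror` (take `z = 0`). -/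
theorem awayTwoMirror_of_deepHalfRel (h : DeepHalfRel c₂ cS loc₂ locS ld₂ ldS) :
    AwayTwoMirror cS locS ld₂ ldS := by
  intro χ hχ
  obtain ⟨a, ha, x, hx⟩ := h (0, χ) fun s ↦ by
    show c₂ 0 (loc₂ s) + cS χ (locS s) = 0
    rw [hχ s, map_zero, add_zero]
    rfl
  have h1 : a • (0 : P₀) = ld₂ x := by simpa using congrArg Prod.fst hx
  have h2 : a • χ = ldS x := by simpa using congrArg Prod.snd hx
  exact ⟨a, ha, x, by rw [← h1, smul_zero], h2⟩

/-- Converse slice of the mirror cut at `2`, under the PARTNER hypothesis (every `z` orthogonal to `loc₂` of the Str_S-classes is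
completed by some `χ` to a pair orthogonal to all of `SelRel` — the abstract form of "characters extend + `cS` represents them",
cf. k1-g9 `awayBlock_of_deepHalfRelaxed_of_extends` for A″): `DeepHalfRel ⟹ AtTwoMirror`. -/
theorem atTwoMirror_of_deepHalfRel_of_partner (h : DeepHalfRel c₂ cS loc₂ locS ld₂ ldS)
    (hpartner : ∀ z : P₀, (∀ s : SelRel, locS s = 0 → c₂ z (loc₂ s) = 0) →
      ∃ χ : PS, ∀ s : SelRel, c₂ z (loc₂ s) + cS χ (locS s) = 0) :
    AtTwoMirror c₂ loc₂ locS ld₂ (H := H) := by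
  intro z hz
  obtain ⟨χ, hχ⟩ := hpartner z hz
  obtain ⟨a, ha, x, hx⟩ := h (z, χ) hχ
  exact ⟨a, ha, x, by simpa using congrArg Prod.fst hx⟩

/-- The registered A″ slice away from `2` under the analogous partner hypothesis (for the 2×2 table; k1-g9 has the `_of_extends`
form): `DeepHalfRel ⟹ AwayTwo`. -/
theorem awayTwo_of_deepHalfRel_of_partner (h : DeepHalfRel c₂ cS loc₂ locS ld₂ ldS)
    (hpartner : ∀ χ : PS, (∀ s : SelRel, loc₂ s = 0 → cS χ (locS s) = 0) →
      ∃ z : P₀, ∀ s : SelRel, c₂ z (loc₂ s) + cS χ (locS s) = 0) :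
    AwayTwo cS loc₂ locS ldS (H := H) := by
  intro χ hχ
  obtain ⟨z, hz⟩ := hpartner χ hχ
  obtain ⟨a, ha, x, hx⟩ := h (z, χ) hz
  exact ⟨a, ha, x, by simpa using congrArg Prod.snd hx⟩

/-- **Slack bookkeeping**: if both registered halves hold SLACK-FREE (`a = 1`, the expected values: S4₀ by UN_ρ, S4₂ by exact
levelwise PT) then `hDHrel` holds slack-free — the glue multiplies slacks (`a = a₁ a₀`), it never creates any. No domain hypothesis. -/
theorem deepHalfRelExact_of_placeCutExact
    (hEH : Recip c₂ cS loc₂ locS ld₂ ldS)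
    (h2 : ∀ z : P₀, (∀ s : SelRel, c₂ z (loc₂ s) = 0) → ∃ x : H, ldS x = 0 ∧ z = ld₂ x)
    (h0 : ∀ χ : PS, (∀ s : SelRel, loc₂ s = 0 → cS χ (locS s) = 0) → ∃ x : H, χ = ldS x) :
    ∀ t : P₀ × PS, (∀ s : SelRel, c₂ t.1 (loc₂ s) + cS t.2 (locS s) = 0) → ∃ x : H, t = (ld₂.prod ldS) x := by
  rintro ⟨z, χ⟩ ht
  have hχ : ∀ s : SelRel, loc₂ s = 0 → cS χ (locS s) = 0 := by
    intro s hs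
    have h := ht s
    rw [hs, map_zero, zero_add] at h
    exact h
  obtain ⟨x₀, hx₀⟩ := h0 χ hχ
  have hz' : ∀ s : SelRel, c₂ (z - ld₂ x₀) (loc₂ s) = 0 := by
    intro s
    have h1 : c₂ z (loc₂ s) + cS χ (locS s) = 0 := ht s
    have h2' : c₂ (ld₂ x₀) (loc₂ s) + cS (ldS x₀) (locS s) = 0 := hEH x₀ s
    rw [← hx₀] at h2'
    have e0 : c₂ (z - ld₂ x₀) (loc₂ s) = c₂ z (loc₂ s) - c₂ (ld₂ x₀) (loc₂ s) := by
      rw [map_sub c₂]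
      rfl
    rw [e0, eq_neg_of_add_eq_zero_left h1, eq_neg_of_add_eq_zero_left h2', sub_self]
  obtain ⟨x₁, hx₁S, hx₁⟩ := h2 _ hz'
  refine ⟨x₀ + x₁, Prod.ext ?_ ?_⟩
  · show z = ld₂ (x₀ + x₁)
    rw [map_add, ← hx₁, add_sub_cancel]
  · show χ = ldS (x₀ + x₁)
    rw [map_add, hx₁S, add_zero, hx₀]

end Mirror

/-! ## §2 Negative: separating toy data over `A := ℚ` (characters through `ℚ → ℚ/ℤ`) -/

section Toys

/-- evaluation of the zero character (definitional; recorded for `simp`) -/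
theorem characterModule_zero_apply {D : Type} [AddCommGroup D] (d : D) : (0 : CharacterModule D) d = 0 := rfl

/-- The basic character `ℚ → ℚ/ℤ = AddCircle (1 : ℚ)`. -/
def π₁ : CharacterModule ℚ := (QuotientAddGroup.mk' (AddSubgroup.zmultiples (1 : ℚ)) : ℚ →+ AddCircle (1 : ℚ))

theorem π₁_apply (q : ℚ) : π₁ q = ((q : ℚ) : AddCircle (1 : ℚ)) := rfl

theorem π₁_half_ne_zero : π₁ (1 / 2 : ℚ) ≠ 0 := by
  rw [π₁_apply, Ne, AddCircle.coe_eq_zero_iff]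
  rintro ⟨n, hn⟩
  rw [zsmul_eq_mul, mul_one] at hn
  have h2 : ((2 * n : ℤ) : ℚ) = 1 := by push_cast; rw [hn]; norm_num
  have h3 : (2 * n : ℤ) = 1 := by exact_mod_cast h2
  omega

/-- Separation lemma: a rational whose every multiple is an integer is `0`. -/
theorem eq_zero_of_forall_π₁_mul_eq_zero (r : ℚ) (h : ∀ s : ℚ, π₁ (r * s) = 0) : r = 0 := by
  by_contra hr
  have key := h (2 * r)⁻¹
  have e : r * (2 * r)⁻¹ = 1 / 2 := by field_simp
  rw [e] at key
  exact π₁_half_ne_zero key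

/-- The pairing map used in all toys: `c z := (s ↦ z s mod ℤ)`, i.e. `z ↦ z • π₁` (contravariant action). -/
def cπ : ℚ →ₗ[ℚ] CharacterModule ℚ := LinearMap.toSpanSingleton ℚ (CharacterModule ℚ) π₁

theorem cπ_apply (z s : ℚ) : cπ z s = π₁ (z * s) := by
  simp [cπ, LinearMap.toSpanSingleton_apply, CharacterModule.smul_apply, smul_eq_mul]

theorem cπ_orth_iff (z : ℚ) : (∀ s : ℚ, cπ z s = 0) ↔ z = 0 := by
  refine ⟨fun h ↦ eq_zero_of_forall_π₁_mul_eq_zero z fun s ↦ by rw [← cπ_apply]; exact h s, ?_⟩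
  rintro rfl s
  rw [map_zero]
  rfl

/-- `cπ` precomposed with negation: `cπneg χ s = π₁ (-(χ s))`. -/
def cπneg : ℚ →ₗ[ℚ] CharacterModule ℚ := cπ ∘ₗ (-LinearMap.id)

theorem cπneg_apply (χ s : ℚ) : cπneg χ s = π₁ (-χ * s) := by
  unfold cπneg
  rw [LinearMap.comp_apply, LinearMap.neg_apply, LinearMap.id_apply, cπ_apply]

theorem cπ_add_cπneg (z χ s : ℚ) : cπ z s + cπneg χ s = π₁ ((z - χ) * s) := by
  rw [cπ_apply, cπneg_apply, π₁_apply, π₁_apply, π₁_apply, ← AddCircle.coe_add]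
  congr 1
  ring

theorem cπ_add_cπ (z χ s : ℚ) : cπ z s + cπ χ s = π₁ ((z + χ) * s) := by
  rw [cπ_apply, cπ_apply, π₁_apply, π₁_apply, π₁_apply, ← AddCircle.coe_add]
  congr 1
  ring

/-! ### Toy 1 — `SelRel = PUnit` (no test classes), `H = P₀ = PS = ℚ`, `ld₂ = ldS = id` (diagonal image).
Everything with a free conclusion holds; `DeepHalfRel` fails at `t = (1, 0)`.  Kills OPPOSITE 1 (`AtTwoFree`) and the
restricted/restricted hybrid (`AtTwoMirror ∧ AwayTwo`). -/

/-- data of toy 1: the local maps out of the zero module of test classes -/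
def toy₁loc : PUnit.{1} →ₗ[ℚ] ℚ := 0

theorem toy₁_atTwoFree : AtTwoFree (H := ℚ) cπ toy₁loc LinearMap.id :=
  fun z _ ↦ ⟨1, one_ne_zero, z, by simp⟩

theorem toy₁_atTwoMirror : AtTwoMirror (H := ℚ) cπ toy₁loc toy₁loc LinearMap.id :=
  fun z _ ↦ ⟨1, one_ne_zero, z, by simp⟩

theorem toy₁_awayTwo : AwayTwo (H := ℚ) cπ toy₁loc toy₁loc LinearMap.id :=
  fun χ _ ↦ ⟨1, one_ne_zero, χ, by simp⟩

theorem toy₁_awayTwoWide : AwayTwoWide (H := ℚ) cπ toy₁loc LinearMap.id :=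
  fun χ _ ↦ ⟨1, one_ne_zero, χ, by simp⟩

theorem toy₁_recip : Recip cπ cπ toy₁loc toy₁loc (LinearMap.id (M := ℚ)) LinearMap.id := by
  intro x s
  simp only [toy₁loc, LinearMap.zero_apply, map_zero, add_zero]

theorem toy₁_not_deepHalfRel : ¬ DeepHalfRel cπ cπ toy₁loc toy₁loc (LinearMap.id (M := ℚ)) LinearMap.id := by
  intro h
  obtain ⟨a, ha, x, hx⟩ := h ((1 : ℚ), (0 : ℚ)) fun s ↦ by
    simp only [toy₁loc, LinearMap.zero_apply, map_zero, add_zero]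
  have h1 : a * 1 = x := by simpa using congrArg Prod.fst hx
  have h2 : a * 0 = x := by simpa using congrArg Prod.snd hx
  exact ha (by rw [mul_zero] at h2; rw [mul_one] at h1; rw [h1, ← h2])

/-- Toy 1 packaged: S4₂-without-`ldS x = 0` (even together with the mirror half at `2`, S4₀, its wide form and EH) does NOT give `hDHrel`. -/
theorem atTwoFree_not_sufficient :
    ∃ (c₂ cS : ℚ →ₗ[ℚ] CharacterModule ℚ) (loc₂ locS : PUnit.{1} →ₗ[ℚ] ℚ) (ld₂ ldS : ℚ →ₗ[ℚ] ℚ),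
      AtTwoFree (H := ℚ) c₂ loc₂ ld₂ ∧ AtTwoMirror (H := ℚ) c₂ loc₂ locS ld₂ ∧ AwayTwo (H := ℚ) cS loc₂ locS ldS ∧
      AwayTwoWide (H := ℚ) cS locS ldS ∧ Recip c₂ cS loc₂ locS ld₂ ldS ∧ ¬ DeepHalfRel c₂ cS loc₂ locS ld₂ ldS :=
  ⟨cπ, cπ, toy₁loc, toy₁loc, LinearMap.id, LinearMap.id, toy₁_atTwoFree, toy₁_atTwoMirror, toy₁_awayTwo, toy₁_awayTwoWide,
    toy₁_recip, toy₁_not_deepHalfRel⟩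

/-! ### Toy 2 — `SelRel = D₂ = DS = ℚ` (`loc = id`), `P₀ = PS = ℚ`, `c₂ = cπ`, `cS = cπneg` (so `(z, χ) ⊥ SelRel ↔ z = χ`),
`H = PUnit` (no global classes).  `AtTwoStrict`, `AwayTwoWide`, `AwayTwoMirror`, `Recip` hold; `DeepHalfRel` fails at `(1, 1)` and
the registered `AwayTwo` fails at `χ = 1`.  Kills OPPOSITE 2 (`AwayTwoWide`) and the strict/strict hybrid (`AtTwoStrict ∧ AwayTwoMirror`). -/

/-- data of toy 2: no global classes -/
def toy₂ld : PUnit.{1} →ₗ[ℚ] ℚ := 0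

theorem toy₂_atTwoStrict : AtTwoStrict cπ (LinearMap.id (M := ℚ)) toy₂ld toy₂ld := by
  intro z hz
  have hz0 : z = 0 := (cπ_orth_iff z).1 fun s ↦ by simpa using hz s
  exact ⟨1, one_ne_zero, PUnit.unit, by simp [toy₂ld], by simp [toy₂ld, hz0]⟩

theorem toy₂_awayTwoWide : AwayTwoWide cπneg (LinearMap.id (M := ℚ)) toy₂ld (H := PUnit) := by
  intro χ hχ
  have hχ0 : -χ = 0 := eq_zero_of_forall_π₁_mul_eq_zero (-χ) fun s ↦ by rw [← cπneg_apply]; simpa using hχ s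
  exact ⟨1, one_ne_zero, PUnit.unit, by simp [toy₂ld, neg_eq_zero.mp hχ0]⟩

theorem toy₂_awayTwoMirror : AwayTwoMirror cπneg (LinearMap.id (M := ℚ)) toy₂ld toy₂ld := by
  intro χ hχ
  have hχ0 : -χ = 0 := eq_zero_of_forall_π₁_mul_eq_zero (-χ) fun s ↦ by rw [← cπneg_apply]; simpa using hχ s
  exact ⟨1, one_ne_zero, PUnit.unit, by simp [toy₂ld], by simp [toy₂ld, neg_eq_zero.mp hχ0]⟩

theorem toy₂_recip : Recip cπ cπneg (LinearMap.id (M := ℚ)) LinearMap.id toy₂ld toy₂ld := by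
  intro x s
  simp only [toy₂ld, LinearMap.zero_apply, map_zero, characterModule_zero_apply, add_zero]

theorem toy₂_not_deepHalfRel : ¬ DeepHalfRel cπ cπneg (LinearMap.id (M := ℚ)) LinearMap.id toy₂ld toy₂ld := by
  intro h
  obtain ⟨a, ha, x, hx⟩ := h ((1 : ℚ), (1 : ℚ)) fun s ↦ by
    show cπ 1 (LinearMap.id s) + cπneg 1 (LinearMap.id s) = 0
    rw [LinearMap.id_apply, cπ_add_cπneg, sub_self, zero_mul, map_zero]
  have h1 : a * 1 = 0 := by simpa [toy₂ld] using congrArg Prod.fst hx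
  exact ha (by simpa using h1)

/-- … and, as it must (contrapositive of `hDHrel_of_placeCut`), the REGISTERED S4₀ fails in toy 2 (at `χ = 1`). -/
theorem toy₂_not_awayTwo : ¬ AwayTwo cπneg (LinearMap.id (M := ℚ)) LinearMap.id toy₂ld (H := PUnit) := by
  intro h
  obtain ⟨a, ha, x, hx⟩ := h 1 fun s hs ↦ by
    rw [LinearMap.id_apply] at hs
    rw [hs, map_zero, map_zero]
  have h1 : a * 1 = 0 := by simpa [toy₂ld] using hx
  exact ha (by simpa using h1)

/-- Toy 2 packaged: S4₀ with the SelRel-WIDE hypothesis (even together with S4₂, the mirror half away from `2` and EH) does NOT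
give `hDHrel`; the Str₂-restricted hypothesis of the registered S4₀ is load-bearing. -/
theorem awayTwoWide_not_sufficient :
    ∃ (c₂ cS : ℚ →ₗ[ℚ] CharacterModule ℚ) (loc₂ locS : ℚ →ₗ[ℚ] ℚ) (ld₂ ldS : PUnit.{1} →ₗ[ℚ] ℚ),
      AtTwoStrict c₂ loc₂ ld₂ ldS ∧ AwayTwoWide cS locS ldS (H := PUnit) ∧ AwayTwoMirror cS locS ld₂ ldS ∧
      Recip c₂ cS loc₂ locS ld₂ ldS ∧ ¬ DeepHalfRel c₂ cS loc₂ locS ld₂ ldS ∧ ¬ AwayTwo cS loc₂ locS ldS (H := PUnit) :=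
  ⟨cπ, cπneg, LinearMap.id, LinearMap.id, toy₂ld, toy₂ld, toy₂_atTwoStrict, toy₂_awayTwoWide, toy₂_awayTwoMirror, toy₂_recip,
    toy₂_not_deepHalfRel, toy₂_not_awayTwo⟩

/-! ### Toy 3 — `SelRel = D₂ = DS = ℚ` (`loc = id`), `P₀ = PS = H = ℚ`, `ld₂ = ldS = id`, `c₂ = cS = cπ` (so `⊥ ↔ χ = -z`).
Both registered halves hold SLACK-FREE, reciprocity FAILS, `DeepHalfRel` fails at `(1, -1)`: EH is not redundant. -/

theorem toy₃_atTwoStrict : AtTwoStrict cπ (LinearMap.id (M := ℚ)) (LinearMap.id (M := ℚ)) LinearMap.id := by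
  intro z hz
  have hz0 : z = 0 := (cπ_orth_iff z).1 fun s ↦ by simpa using hz s
  exact ⟨1, one_ne_zero, 0, by simp, by simp [hz0]⟩

theorem toy₃_awayTwo : AwayTwo cπ (LinearMap.id (M := ℚ)) (LinearMap.id (M := ℚ)) (LinearMap.id (M := ℚ)) (H := ℚ) :=
  fun χ _ ↦ ⟨1, one_ne_zero, χ, by simp⟩

theorem toy₃_not_recip : ¬ Recip cπ cπ (LinearMap.id (M := ℚ)) LinearMap.id (LinearMap.id (M := ℚ)) LinearMap.id := by
  intro h
  have key : cπ 1 (1 / 4 : ℚ) + cπ 1 (1 / 4 : ℚ) = 0 := h 1 (1 / 4)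
  rw [cπ_add_cπ] at key
  have e : ((1 : ℚ) + 1) * (1 / 4) = 1 / 2 := by norm_num
  rw [e] at key
  exact π₁_half_ne_zero key

theorem toy₃_not_deepHalfRel :
    ¬ DeepHalfRel cπ cπ (LinearMap.id (M := ℚ)) LinearMap.id (LinearMap.id (M := ℚ)) LinearMap.id := by
  intro h
  obtain ⟨a, ha, x, hx⟩ := h ((1 : ℚ), (-1 : ℚ)) fun s ↦ by
    show cπ 1 (LinearMap.id s) + cπ (-1) (LinearMap.id s) = 0
    rw [LinearMap.id_apply, cπ_add_cπ, add_neg_cancel, zero_mul, map_zero]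
  have h1 : a * 1 = x := by simpa using congrArg Prod.fst hx
  have h2 : a * (-1) = x := by simpa using congrArg Prod.snd hx
  have : a = 0 := by linarith
  exact ha this

/-- Toy 3 packaged: without EH the two registered halves (here even slack-free) do NOT give `hDHrel`. -/
theorem recip_necessary :
    ∃ (c₂ cS : ℚ →ₗ[ℚ] CharacterModule ℚ) (loc₂ locS ld₂ ldS : ℚ →ₗ[ℚ] ℚ),
      AtTwoStrict c₂ loc₂ ld₂ ldS ∧ AwayTwo cS loc₂ locS ldS (H := ℚ) ∧
      ¬ Recip c₂ cS loc₂ locS ld₂ ldS ∧ ¬ DeepHalfRel c₂ cS loc₂ locS ld₂ ldS :=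
  ⟨cπ, cπ, LinearMap.id, LinearMap.id, LinearMap.id, LinearMap.id, toy₃_atTwoStrict, toy₃_awayTwo, toy₃_not_recip,
    toy₃_not_deepHalfRel⟩

end Toys

end Summit.BirchSwinnertonDyer.BirchSwinnertonDyer.Cruxes.ResidualThetaCountLowerPureAtTwo.SideaK4G16

end
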